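import Literature.AlgebraicGeometry.Resolution.ArithmeticalThreefoldsLocalSeparableClimb
import Literature.AlgebraicGeometry.Resolution.ArithmeticalThreefoldsReductionChar0
import Literature.AlgebraicGeometry.Resolution.CofinalityFromPrincipalizationAssembly
import HarnessLib

/-!
# `CossartPiltant2019LUCompleteChar0` from the characteristic-free inputs of Cossart–Piltant's climb

Topic: `Literature/AlgebraicGeometry/Resolution`. PROOF side of the named fact
`CossartPiltant2019LUCompleteChar0` (`ArithmeticalThreefoldsLocal.lean`): local uniformization
(LU) for complete Noetherian local domains of dimension three and residue characteristic ZERO,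
the case Cossart–Piltant 2019 dismiss in the proof of Prop. 4.10 (arXiv v1 Prop. 4.8, p. 53:
"We may assume here that `char k_v = p > 0`, the equicharacteristic zero version of theorem
(mainthm) being known"). Companion of

* `ArithmeticalThreefoldsReductionChar0.lean` — `CossartPiltant2019LUCompleteChar0.of_climb`:
  the fact follows from Cossart–Piltant's CLIMBING statement at residue characteristic `0`
  (Cohen subring `S ⊆ A`, ambient algebraically closed valued field `(E, O_E)`);
* `ArithmeticalThreefoldsLocalSeparableClimb.lean` — `cossartPiltant2019ReductionP_of_parts`:
  in residue characteristic `p > 0` the climb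
  `(LU v₀) ⇒ (LU v₀ⁱ) ⇒ (LU v₀ʳ) ⇒ (LU vʳ) ⇒ (LU v)` is assembled from the local theorem
  (Thm. 1.5) and four inputs of the printed proof which the source calls characteristic free:
  (COF) cofinality of local uniformizations ([CoP1] Cor. 4.6 ⇐ principalization, Prop. 4.4),
  (C3) tame ascent ([CoP1] Prop. 6.3), (C4) descent below the ramification field ([CoP1]
  Prop. 9.3), (C5) reduction to rank one ([NSp]).

This file runs the SAME chain in residue characteristic `0`, where it needs neither Thm. 1.5 nor
any `p`-th roots of unity: `char E = 0`, so `K = Frac(S)(s₀)` is separable over `F = Frac S` and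
sits in a finite Galois `N | F`; the large ramification group `G_V` of `O_E ∩ N` is trivial
(Zariski–Samuel VI §12 Thm. 24, `ramificationGroupIn_eq_bot_of_charZero`), so `Fʳ = N`
(`lift_fixedField_ramificationGroupIn_toSubfield_eq_of_charZero`), the step
`(LU v₀ʳ) ⇒ (LU vʳ)` is empty and `Fʳ | Fⁱ = N | Fⁱ` is a tower of Galois steps of prime
degree (`isPrimeGaloisTower_inertiaField_ramificationField_of_charZero`: `G_T` is abelian,
`commutator_mem_ramificationGroupIn`). Hence:

* `isPrimeGaloisTower_inertiaField_ramificationField_of_charZero` — PROVED: the residue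
  characteristic `0` twin of `isPrimeGaloisTower_inertiaField_ramificationField`.
* `lift_fixedField_ramificationGroupIn_toSubfield_eq_of_charZero` — PROVED: `Fʳ = N` as
  subfields of the ambient field.
* `cofinality_of_principalization₀` — PROVED: (COF) from `CossartPiltant2019Principalization`
  with NO residue-characteristic hypothesis (the derivation
  `exists_model_mem_localRing_of_principalization` of `CofinalityFromPrincipalizationAssembly.lean`
  is characteristic free; `cofinality_of_principalization` there merely carries the unused
  binders `p.Prime`, `CharP (S/𝔪) p` of the characteristic-`p` frame).
* `CossartPiltant2019LUCompleteChar0.of_parts` — PROVED: **(COF), (C3), (C4), (C5), each stated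
  in the climbing frame at residue characteristic `0`, imply `CossartPiltant2019LUCompleteChar0`.**
* `CossartPiltant2019LUCompleteChar0.of_principalization` — PROVED: the same with (COF)
  discharged from the named fact `CossartPiltant2019Principalization` (Prop. 4.4).

So, once the three remaining characteristic-free inputs (C3), (C4), (C5) of
`cossartPiltant2019ReductionP_of_parts` are theorems of the tree in a form covering residue
characteristic `0`, `CossartPiltant2019LUCompleteChar0_holds` is
`CossartPiltant2019LUCompleteChar0.of_principalization CossartPiltant2019Principalization_holds
hC3 hC4 hC5` — with no appeal to Hironaka's theorem (`Hironaka1964_local`, the other road: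
`LUCompleteChar0TrustBase.lean`).

Everything is PROVED; no named facts are introduced (the inputs appear only as hypotheses,
`CossartPiltant2019Principalization` as the hypothesis `h44`).

## Sources

* V. Cossart, O. Piltant, *Resolution of singularities of arithmetical threefolds*, J. Algebra
  529 (2019) 268–535 = arXiv:1412.0868, proof of Prop. 4.10 (arXiv v1: Prop. 4.8, pp. 53–54),
  Prop. 4.4. [CossartPiltant2019]
* V. Cossart, O. Piltant, *Resolution of singularities of threefolds in positive
  characteristic I*, J. Algebra 320 (2008) 1051–1082: Cor. 4.6, Prop. 6.3, Thm. 8.1, Prop. 9.3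
  (HAL hal-00139124: Cor. 4.6, Prop. 8.3, Thm. 7.2, Prop. 9.5). [CossartPiltant2008]
* O. Zariski, P. Samuel, *Commutative Algebra* II (1960), Ch. VI §12, Thm. 24 and (23).
  [ZariskiSamuel1960]
* J. Novacoski, M. Spivakovsky, *Reduction of local uniformization to the rank one case*
  (2014), Thm. 1.1. [NovacoskiSpivakovsky2014]
-/

noncomputable section

open IsLocalRing Polynomial IntermediateField Module

namespace Literature.AlgebraicGeometry.Resolution

universe u

/-! ## Residue characteristic zero: the ramification field is the top, the tame tower reaches it -/

section Fields

variable {Ω : Type u} [Field Ω] (V : ValuationSubring Ω) {M : Subfield Ω}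
  (N : IntermediateField M Ω) [FiniteDimensional M N]

/-- **`Fʳ | Fⁱ` is a tower of Galois extensions of prime degrees, residue characteristic `0`**
(the twin of `isPrimeGaloisTower_inertiaField_ramificationField` at `p = 0`: in
`IsPrimeGaloisStep 0` the condition `ℓ ≠ 0` on the prime degrees is vacuous). For `N | M`
finite Galois inside the valued field `(Ω, V)`: `G_V ≤ G_T` contains the commutators of `G_T`
(Zariski–Samuel VI §12 (23), `commutator_mem_ramificationGroupIn`, characteristic free) and has
finite, hence nonzero, index, so the group-theoretic refinement `isPrimeGaloisTower_fixedField`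
of `AbelianPrimeGaloisTower.lean` applies. (In residue characteristic `0` moreover `G_V = 1`,
so the tower reaches `N`: `lift_fixedField_ramificationGroupIn_toSubfield_eq_of_charZero`.)
[cite: CossartPiltant2019, proof of Prop. 4.10 (arXiv v1: Prop. 4.8, p. 54)]
[cite: ZariskiSamuel1960, Ch. VI §12, (23) and Thm. 24] -/
theorem isPrimeGaloisTower_inertiaField_ramificationField_of_charZero [IsGalois M N] :
    IsPrimeGaloisTower 0 (lift (fixedField (inertiaGroupIn V N))).toSubfield
      (lift (fixedField (ramificationGroupIn V N))).toSubfield :=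
  isPrimeGaloisTower_fixedField 0 _ (inertiaGroupIn V N) (ramificationGroupIn V N)
    (ramificationGroupIn_le_inertiaGroupIn V N)
    (fun _ hs _ ht => commutator_mem_ramificationGroupIn V N hs ht)
    (by
      rw [zero_dvd_iff]
      exact Subgroup.FiniteIndex.index_ne_zero) rfl

/-- **In residue characteristic `0` the ramification field is the whole extension**, as subfields
of the ambient field: `Fʳ = N^{G_V} = N` since `G_V = 1`
(`fixedField_ramificationGroupIn_eq_top_of_charZero`). This is why the step
`(LU v₀ʳ) ⇒ (LU vʳ)` of Cossart–Piltant's chain — the only consumer of Thm. 1.5 (ii) — is empty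
in residue characteristic `0`. [cite: ZariskiSamuel1960, Ch. VI §12, Thm. 24]
[cite: CossartPiltant2019, proof of Prop. 4.10 (arXiv v1: Prop. 4.8, p. 54)] -/
theorem lift_fixedField_ramificationGroupIn_toSubfield_eq_of_charZero
    [CharZero (ResidueField V)] :
    (lift (fixedField (ramificationGroupIn V N))).toSubfield = N.toSubfield := by
  rw [fixedField_ramificationGroupIn_eq_top_of_charZero V N, lift_top]

end Fields

/-! ## Cofinality of local uniformizations from principalization, characteristic free -/

/-- **`CossartPiltant2019Principalization` implies cofinality of local uniformizations,
with no hypothesis on the residue characteristic** ([CoP1] Cor. 4.6: "for any local model `R₀`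
of `V/k`, there exists a local uniformization `R₁` of `V/k` such that `R₀ < R₁` … By induction
on `n`, it can then be assumed that `A₀ ⊆ R′`"): for `S` excellent regular local of dimension
three inside a valued field `(E, O_E)` dominating it with residue field algebraic over that of
`S`, a model `S[t] ⊆ O_E` of a subfield `M ∋ S` regular at the centre, and finitely many
`x ∈ O_E ∩ M`, there is a model `S[t′]`, `t′ ⊆ M`, regular at the centre, whose local ring
contains every `x` (as `x = a/s`, `a, s ∈ S[t′]`, `v(s) = 0`). Induction on the finite set with
the characteristic-free one-element step `exists_model_mem_localRing_of_principalization`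
(models only grow). This is the hypothesis (COF) of `CossartPiltant2019LUCompleteChar0.of_parts`
and, after discarding its characteristic binders, of `cossartPiltant2019ReductionP_of_parts`.
[cite: CossartPiltant2008, Cor. 4.6 (HAL p. 14)] [cite: CossartPiltant2019, Prop. 4.4] -/
theorem cofinality_of_principalization₀ (h44 : CossartPiltant2019Principalization.{u})
    {S E : Type u} [CommRing S] [IsRegularLocalRing S] [Field E] [Algebra S E]
    (hS : IsExcellentRing S) (hSdim : ringKrullDim S = 3)
    (hinj : Function.Injective (algebraMap S E)) [Algebra.IsAlgebraic S E]
    (OE : ValuationSubring E) (hSO : ∀ s : S, algebraMap S E s ∈ OE)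
    (hdom : ∀ s ∈ maximalIdeal S, OE.valuation (algebraMap S E s) < 1)
    (hres : ∀ y : OE, ∃ q : S[X], (∃ i, q.coeff i ∉ maximalIdeal S) ∧
      OE.valuation (q.eval₂ (algebraMap S E) y) < 1)
    (M : Subfield E) (hSM : ∀ s : S, algebraMap S E s ∈ M)
    (t : Finset E) (htM : (t : Set E) ⊆ M)
    (hMcl : M ≤ Subfield.closure (Set.range (algebraMap S E) ∪ (t : Set E)))
    (hTO : (Algebra.adjoin S (t : Set E)).toSubring ≤ OE.toSubring)
    (hreg : IsRegularLocalRing (Localization.AtPrime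
      (Ideal.comap (Subring.inclusion hTO) (maximalIdeal OE))))
    (c : Finset E) (hcM : (c : Set E) ⊆ M) (hcO : ∀ x ∈ c, x ∈ OE) :
    ∃ t' : Finset E, t ⊆ t' ∧ (t' : Set E) ⊆ M ∧
      M ≤ Subfield.closure (Set.range (algebraMap S E) ∪ (t' : Set E)) ∧
      ∃ hTO' : (Algebra.adjoin S (t' : Set E)).toSubring ≤ OE.toSubring,
        IsRegularLocalRing (Localization.AtPrime
          (Ideal.comap (Subring.inclusion hTO') (maximalIdeal OE))) ∧
        ∀ x ∈ c, ∃ a s : E, a ∈ Algebra.adjoin S (t' : Set E) ∧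
          s ∈ Algebra.adjoin S (t' : Set E) ∧ OE.valuation s = 1 ∧ x * s = a := by
  classical
  induction c using Finset.induction_on with
  | empty =>
    exact ⟨t, Finset.Subset.refl t, htM, hMcl, hTO, hreg,
      fun x hx => absurd hx (Finset.notMem_empty x)⟩
  | insert x₀ c hx₀ ih =>
    obtain ⟨t₁, htt₁, ht₁M, hMcl₁, hTO₁, hreg₁, hrep₁⟩ :=
      ih (fun z hz => hcM (by rw [Finset.coe_insert]; exact Set.mem_insert_of_mem _ hz))
        (fun x hx => hcO x (Finset.mem_insert_of_mem hx))
    obtain ⟨t₂, ht₁₂, ht₂M, hMcl₂, hTO₂, hreg₂, a, s, ha, hs, hvs, hxs⟩ :=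
      exists_model_mem_localRing_of_principalization h44 hS hSdim hinj OE hSO hdom hres M hSM t₁
        ht₁M hMcl₁ hTO₁ hreg₁ x₀
        (hcM (by rw [Finset.coe_insert]; exact Set.mem_insert _ _))
        (hcO x₀ (Finset.mem_insert_self _ _))
    have hmono : Algebra.adjoin S (t₁ : Set E) ≤ Algebra.adjoin S (t₂ : Set E) :=
      Algebra.adjoin_mono (Finset.coe_subset.mpr ht₁₂)
    refine ⟨t₂, htt₁.trans ht₁₂, ht₂M, hMcl₂, hTO₂, hreg₂, fun x hx => ?_⟩
    rcases Finset.mem_insert.mp hx with rfl | hx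
    · exact ⟨a, s, ha, hs, hvs, hxs⟩
    · obtain ⟨a', s', ha', hs', hvs', hxs'⟩ := hrep₁ x hx
      exact ⟨a', s', hmono ha', hmono hs', hvs', hxs'⟩

/-! ## The chain in residue characteristic zero -/

section Parts

/-- **`CossartPiltant2019LUCompleteChar0` from the characteristic-free inputs of the proof of
Cossart–Piltant 2019, Prop. 4.10.** Hypotheses, each in the climbing frame of
`CossartPiltant2019LUCompleteChar0.of_climb` (a complete excellent regular local `S` of
dimension three with `char (S/𝔪) = 0` inside an algebraically closed valued field `(E, O_E)`
dominating it with residue field algebraic over that of `S`; "(LU) for the models on a subfield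
`M ∋ S`" = a model `S[t] ⊆ O_E`, `t ⊆ M ⊆ Frac(S)(t)`, regular at the centre):
(COF) cofinality of local uniformizations ([CoP1] Cor. 4.6 ⇐ Prop. 4.4); (C3) tame ascent along
a Galois step of prime degree between the inertia and the ramification field, rank one ([CoP1]
Prop. 6.3 as used in the proof of Thm. 8.1); (C4) descent below the ramification field, rank
one ([CoP1] Prop. 9.3); (C5) reduction to rank-one valuations ([NSp] Thm. 1.1 / [CoP1]
Prop. 5.1). Proof — the source's chain with its characteristic-`p` features switched off:
reduce to the climb (`CossartPiltant2019LUCompleteChar0.of_climb`) and to rank one (C5);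
`char E = 0` (`charZero_of_injective_of_charZero_residueField`), so `K = F(s₀)` lies in the
finite Galois extension `N | F = Frac S` generated by the conjugates of `s₀`; `(LU v₀)`: the
model `S[∅]` (`isRegularLocalRing_centre_adjoin_empty`); `(LU v₀ⁱ)`: unramified ascent modulo
(COF) (`exists_model_inertiaField_of_cofinal`); `(LU v₀ʳ)`: (C3) along the prime Galois tower
`Fⁱ ⊆ ⋯ ⊆ Fʳ` (`isPrimeGaloisTower_inertiaField_ramificationField_of_charZero`); `Fʳ = N` and
likewise for `N` over `K` (`lift_fixedField_ramificationGroupIn_toSubfield_eq_of_charZero`: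
`char (O_E/𝔪) = 0` by `charZero_residueField_valuationSubring_of_forall_mem`), so no Thm. 1.5
step is needed and (C4) descends from `N = Kʳ` to `K`.
[cite: CossartPiltant2019, proof of Prop. 4.10 (arXiv v1: Prop. 4.8, pp. 53–54)] -/
theorem CossartPiltant2019LUCompleteChar0.of_parts
    (hCOF :
      ∀ (S : Type u) [CommRing S] [IsDomain S] [IsRegularLocalRing S],
        IsExcellentRing S → ringKrullDim S = 3 → CharZero (ResidueField S) →
        IsAdicComplete (maximalIdeal S) S →
      ∀ (E : Type u) [Field E] [Algebra S E], Function.Injective (algebraMap S E) →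
        IsAlgClosed E → Algebra.IsAlgebraic S E →
      ∀ (OE : ValuationSubring E), (∀ s : S, algebraMap S E s ∈ OE) →
        (∀ s ∈ maximalIdeal S, OE.valuation (algebraMap S E s) < 1) →
        (∀ y : OE, ∃ q : S[X], (∃ i, q.coeff i ∉ maximalIdeal S) ∧
          OE.valuation (q.eval₂ (algebraMap S E) y) < 1) →
      ∀ (M : Subfield E), (∀ s : S, algebraMap S E s ∈ M) →
      ∀ (t : Finset E), (t : Set E) ⊆ M →
        M ≤ Subfield.closure (Set.range (algebraMap S E) ∪ (t : Set E)) →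
      ∀ (hTO : (Algebra.adjoin S (t : Set E)).toSubring ≤ OE.toSubring),
        IsRegularLocalRing (Localization.AtPrime
          (Ideal.comap (Subring.inclusion hTO) (maximalIdeal OE))) →
      ∀ (c : Finset E), (c : Set E) ⊆ M → (∀ x ∈ c, x ∈ OE) →
      ∃ t' : Finset E, (t' : Set E) ⊆ M ∧
        M ≤ Subfield.closure (Set.range (algebraMap S E) ∪ (t' : Set E)) ∧
        ∃ hTO' : (Algebra.adjoin S (t' : Set E)).toSubring ≤ OE.toSubring,
          IsRegularLocalRing (Localization.AtPrime
            (Ideal.comap (Subring.inclusion hTO') (maximalIdeal OE))) ∧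
          ∀ x ∈ c, ∃ a s : E, a ∈ Algebra.adjoin S (t' : Set E) ∧
            s ∈ Algebra.adjoin S (t' : Set E) ∧ OE.valuation s = 1 ∧ x * s = a)
    (hC3 :
      ∀ (S : Type u) [CommRing S] [IsDomain S] [IsRegularLocalRing S],
        IsExcellentRing S → ringKrullDim S = 3 → CharZero (ResidueField S) →
        IsAdicComplete (maximalIdeal S) S →
      ∀ (E : Type u) [Field E] [Algebra S E], Function.Injective (algebraMap S E) →
        IsAlgClosed E → Algebra.IsAlgebraic S E →
      ∀ (OE : ValuationSubring E), (∀ s : S, algebraMap S E s ∈ OE) →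
        (∀ s ∈ maximalIdeal S, OE.valuation (algebraMap S E s) < 1) →
        (∀ y : OE, ∃ q : S[X], (∃ i, q.coeff i ∉ maximalIdeal S) ∧
          OE.valuation (q.eval₂ (algebraMap S E) y) < 1) →
      Nonempty OE.valuation.RankOne →
      ∀ (M : Subfield E), (∀ s : S, algebraMap S E s ∈ M) →
      ∀ (N : IntermediateField M E) [FiniteDimensional M N] [IsGalois M N] (A B : Subfield E),
        (lift (fixedField (inertiaGroupIn OE N))).toSubfield ≤ A →
        B ≤ (lift (fixedField (ramificationGroupIn OE N))).toSubfield →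
        IsPrimeGaloisStep 0 A B →
        (∃ t : Finset E, (t : Set E) ⊆ A ∧
          A ≤ Subfield.closure (Set.range (algebraMap S E) ∪ (t : Set E)) ∧
          ∃ hTO : (Algebra.adjoin S (t : Set E)).toSubring ≤ OE.toSubring,
            IsRegularLocalRing (Localization.AtPrime
              (Ideal.comap (Subring.inclusion hTO) (maximalIdeal OE)))) →
        (∃ t : Finset E, (t : Set E) ⊆ B ∧
          B ≤ Subfield.closure (Set.range (algebraMap S E) ∪ (t : Set E)) ∧
          ∃ hTO : (Algebra.adjoin S (t : Set E)).toSubring ≤ OE.toSubring,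
            IsRegularLocalRing (Localization.AtPrime
              (Ideal.comap (Subring.inclusion hTO) (maximalIdeal OE)))))
    (hC4 :
      ∀ (S : Type u) [CommRing S] [IsDomain S] [IsRegularLocalRing S],
        IsExcellentRing S → ringKrullDim S = 3 → CharZero (ResidueField S) →
        IsAdicComplete (maximalIdeal S) S →
      ∀ (E : Type u) [Field E] [Algebra S E], Function.Injective (algebraMap S E) →
        IsAlgClosed E → Algebra.IsAlgebraic S E →
      ∀ (OE : ValuationSubring E), (∀ s : S, algebraMap S E s ∈ OE) →
        (∀ s ∈ maximalIdeal S, OE.valuation (algebraMap S E s) < 1) →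
        (∀ y : OE, ∃ q : S[X], (∃ i, q.coeff i ∉ maximalIdeal S) ∧
          OE.valuation (q.eval₂ (algebraMap S E) y) < 1) →
      Nonempty OE.valuation.RankOne →
      ∀ (M : Subfield E), (∀ s : S, algebraMap S E s ∈ M) →
      ∀ (N : IntermediateField M E) [FiniteDimensional M N] [IsGalois M N] (K' : Subfield E),
        M ≤ K' → K' ≤ (lift (fixedField (ramificationGroupIn OE N))).toSubfield →
        (∃ t : Finset E, (t : Set E) ⊆ K' ∧
          K' ≤ Subfield.closure (Set.range (algebraMap S E) ∪ (t : Set E)) ∧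
          ∃ hTO : (Algebra.adjoin S (t : Set E)).toSubring ≤ OE.toSubring,
            IsRegularLocalRing (Localization.AtPrime
              (Ideal.comap (Subring.inclusion hTO) (maximalIdeal OE)))) →
        (∃ t : Finset E, (t : Set E) ⊆ M ∧
          M ≤ Subfield.closure (Set.range (algebraMap S E) ∪ (t : Set E)) ∧
          ∃ hTO : (Algebra.adjoin S (t : Set E)).toSubring ≤ OE.toSubring,
            IsRegularLocalRing (Localization.AtPrime
              (Ideal.comap (Subring.inclusion hTO) (maximalIdeal OE)))))
    (hC5 :
      ∀ (S : Type u) [CommRing S] [IsDomain S] [IsRegularLocalRing S],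
        IsExcellentRing S → ringKrullDim S = 3 → CharZero (ResidueField S) →
        IsAdicComplete (maximalIdeal S) S →
      ∀ (E : Type u) [Field E] [Algebra S E], Function.Injective (algebraMap S E) →
        IsAlgClosed E → Algebra.IsAlgebraic S E →
      (∀ (OE : ValuationSubring E), Nonempty OE.valuation.RankOne →
        (∀ s : S, algebraMap S E s ∈ OE) →
        (∀ s ∈ maximalIdeal S, OE.valuation (algebraMap S E s) < 1) →
        (∀ y : OE, ∃ q : S[X], (∃ i, q.coeff i ∉ maximalIdeal S) ∧
          OE.valuation (q.eval₂ (algebraMap S E) y) < 1) →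
        ∀ s₀ : Finset E, ∃ t : Finset E,
            (t : Set E) ⊆ Subfield.closure (Set.range (algebraMap S E) ∪ (s₀ : Set E)) ∧
            (s₀ : Set E) ⊆ Subfield.closure (Set.range (algebraMap S E) ∪ (t : Set E)) ∧
            ∃ hTO : (Algebra.adjoin S (t : Set E)).toSubring ≤ OE.toSubring,
              IsRegularLocalRing (Localization.AtPrime
                (Ideal.comap (Subring.inclusion hTO) (maximalIdeal OE)))) →
      ∀ (OE : ValuationSubring E), (∀ s : S, algebraMap S E s ∈ OE) →
        (∀ s ∈ maximalIdeal S, OE.valuation (algebraMap S E s) < 1) →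
        (∀ y : OE, ∃ q : S[X], (∃ i, q.coeff i ∉ maximalIdeal S) ∧
          OE.valuation (q.eval₂ (algebraMap S E) y) < 1) →
        ∀ s₀ : Finset E, ∃ t : Finset E,
            (t : Set E) ⊆ Subfield.closure (Set.range (algebraMap S E) ∪ (s₀ : Set E)) ∧
            (s₀ : Set E) ⊆ Subfield.closure (Set.range (algebraMap S E) ∪ (t : Set E)) ∧
            ∃ hTO : (Algebra.adjoin S (t : Set E)).toSubring ≤ OE.toSubring,
              IsRegularLocalRing (Localization.AtPrime
                (Ideal.comap (Subring.inclusion hTO) (maximalIdeal OE)))) :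
    CossartPiltant2019LUCompleteChar0.{u} := by
  refine CossartPiltant2019LUCompleteChar0.of_climb fun S _ _ _ hS hSdim hSchar hScomp E _ _
    hinj hE halg OE₀ hSO₀ hdom₀ hres₀ s₀' => ?_
  refine hC5 S hS hSdim hSchar hScomp E hinj hE halg ?_ OE₀ hSO₀ hdom₀ hres₀ s₀'
  intro OE hrank hSO hdom hres s₀
  classical
  haveI := hSchar
  haveI : CharZero (ResidueField OE) :=
    charZero_residueField_valuationSubring_of_forall_mem OE hSO
  haveI : CharZero E := charZero_of_injective_of_charZero_residueField hinj
  -- the base subfield `F = Frac S ⊆ E`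
  let F₀ : Subfield E := Subfield.closure (Set.range (algebraMap S E))
  have hSF₀ : ∀ s : S, algebraMap S E s ∈ F₀ := fun s => Subfield.subset_closure ⟨s, rfl⟩
  -- every element of `E` is integral over `F`
  have hint : ∀ x : E, IsIntegral F₀ x := by
    intro x
    obtain ⟨q, hq0, hqx⟩ := Algebra.IsAlgebraic.isAlgebraic (R := S) x
    let φ : S →+* F₀ := (algebraMap S E).codRestrict F₀ hSF₀
    have hφ : Function.Injective φ := fun a b h => hinj (congrArg Subtype.val h)
    have hq' : q.map φ ≠ 0 := (Polynomial.map_ne_zero_iff hφ).mpr hq0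
    have hcomp : (algebraMap F₀ E).comp φ = algebraMap S E := RingHom.ext fun _ => rfl
    have haeval : aeval x (q.map φ) = 0 := by
      rw [aeval_def, eval₂_map, hcomp]
      exact hqx
    exact isAlgebraic_iff_isIntegral.mp ⟨q.map φ, hq', haeval⟩
  -- `K = F(s₀)`
  let Ki : IntermediateField F₀ E := IntermediateField.adjoin F₀ (s₀ : Set E)
  haveI hKifd : FiniteDimensional F₀ Ki :=
    IntermediateField.finiteDimensional_adjoin fun x _ => hint x
  have hrangeF₀ : Set.range (algebraMap F₀ E) = (F₀ : Set E) := by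
    ext z
    constructor
    · rintro ⟨w, rfl⟩
      exact w.2
    · intro hz
      exact ⟨⟨z, hz⟩, rfl⟩
  have hKi : Ki.toSubfield = Subfield.closure (Set.range (algebraMap S E) ∪ (s₀ : Set E)) := by
    change (IntermediateField.adjoin F₀ (s₀ : Set E)).toSubfield = _
    rw [IntermediateField.adjoin_toSubfield, hrangeF₀]
    apply le_antisymm
    · refine Subfield.closure_le.mpr ?_
      rintro z (hz | hz)
      · exact Subfield.closure_mono Set.subset_union_left hz
      · exact Subfield.subset_closure (Set.mem_union_right _ hz)
    · refine Subfield.closure_le.mpr ?_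
      rintro z (⟨w, rfl⟩ | hz)
      · exact Subfield.subset_closure (Set.mem_union_left _ (hSF₀ w))
      · exact Subfield.subset_closure (Set.mem_union_right _ hz)
  have hF₀Ki : F₀ ≤ Ki.toSubfield := fun z hz => Ki.algebraMap_mem ⟨z, hz⟩
  -- characteristic `0`: `F` is perfect, so everything is separable over `F`
  haveI : PerfectField F₀ := PerfectField.ofCharZero
  -- the finite Galois extension `N | F` generated by the conjugates of `s₀`
  let P : F₀[X] := ∏ x ∈ s₀, minpoly F₀ x
  have hPne : P ≠ 0 := Finset.prod_ne_zero_iff.mpr fun x _ => minpoly.ne_zero (hint x)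
  have hPsplits : (P.map (algebraMap F₀ E)).Splits := IsAlgClosed.splits _
  let N : IntermediateField F₀ E := IntermediateField.adjoin F₀ (P.rootSet E)
  haveI hsplit : P.IsSplittingField F₀ N :=
    IntermediateField.adjoin_rootSet_isSplittingField hPsplits
  haveI : FiniteDimensional F₀ N := Polynomial.IsSplittingField.finiteDimensional N P
  haveI : Normal F₀ N := Normal.of_isSplittingField P
  haveI : Algebra.IsSeparable F₀ N := Algebra.IsAlgebraic.isSeparable_of_perfectField
  haveI : IsGalois F₀ N := isGalois_iff.mpr ⟨inferInstance, inferInstance⟩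
  have hs₀N : ∀ x ∈ s₀, x ∈ N := fun x hx => by
    refine IntermediateField.subset_adjoin _ _ (Polynomial.mem_rootSet.mpr ⟨hPne, ?_⟩)
    rw [map_prod]
    exact Finset.prod_eq_zero hx (minpoly.aeval F₀ x)
  have hKiN : Ki ≤ N := IntermediateField.adjoin_le_iff.mpr hs₀N
  -- (1) `(LU v₀)`: the base `S[∅]`
  have hTO₀ : (Algebra.adjoin S (((∅ : Finset E) : Finset E) : Set E)).toSubring ≤
      OE.toSubring := by
    intro z hz
    rw [Finset.coe_empty, Algebra.adjoin_empty] at hz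
    obtain ⟨w, rfl⟩ := Algebra.mem_bot.mp hz
    exact hSO w
  have hINV₀ : ∃ t : Finset E, (t : Set E) ⊆ F₀ ∧
      F₀ ≤ Subfield.closure (Set.range (algebraMap S E) ∪ (t : Set E)) ∧
      ∃ hTO : (Algebra.adjoin S (t : Set E)).toSubring ≤ OE.toSubring,
        IsRegularLocalRing (Localization.AtPrime
          (Ideal.comap (Subring.inclusion hTO) (maximalIdeal OE))) := by
    refine ⟨∅, by simp, ?_, hTO₀, isRegularLocalRing_centre_adjoin_empty hinj OE hSO hdom hTO₀⟩
    rw [Finset.coe_empty, Set.union_empty]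
  -- (2) `(LU v₀ⁱ)`: the unramified ascent, modulo cofinality
  have hcof' : ∀ M' : Subfield E,
      (M' = F₀ ∨ M' = (lift (fixedField (decompositionGroupIn OE N))).toSubfield) →
      ∀ (t : Finset E), (t : Set E) ⊆ M' →
      M' ≤ Subfield.closure (Set.range (algebraMap S E) ∪ (t : Set E)) →
      ∀ (hTO : (Algebra.adjoin S (t : Set E)).toSubring ≤ OE.toSubring),
      IsRegularLocalRing (Localization.AtPrime
        (Ideal.comap (Subring.inclusion hTO) (maximalIdeal OE))) →
      ∀ (c : Finset E), (c : Set E) ⊆ M' → (∀ x ∈ c, x ∈ OE) →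
      ∃ t' : Finset E, (t' : Set E) ⊆ M' ∧
        M' ≤ Subfield.closure (Set.range (algebraMap S E) ∪ (t' : Set E)) ∧
        ∃ hTO' : (Algebra.adjoin S (t' : Set E)).toSubring ≤ OE.toSubring,
          IsRegularLocalRing (Localization.AtPrime
            (Ideal.comap (Subring.inclusion hTO') (maximalIdeal OE))) ∧
          ∀ x ∈ c, ∃ a s : E, a ∈ Algebra.adjoin S (t' : Set E) ∧
            s ∈ Algebra.adjoin S (t' : Set E) ∧ OE.valuation s = 1 ∧ x * s = a := by
    intro M' hM'
    have hSM' : ∀ s : S, algebraMap S E s ∈ M' := by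
      rcases hM' with rfl | rfl
      · exact hSF₀
      · exact fun s => le_lift_toSubfield _ (hSF₀ s)
    exact hCOF S hS hSdim hSchar hScomp E hinj hE halg OE hSO hdom hres M' hSM'
  have hINVi := exists_model_inertiaField_of_cofinal OE F₀ N hcof' hINV₀
  -- (3) `(LU v₀ʳ)`: the tame ascent along `Fⁱ ⊆ ⋯ ⊆ Fʳ`
  have hINVr : ∃ t : Finset E,
      (t : Set E) ⊆ (lift (fixedField (ramificationGroupIn OE N))).toSubfield ∧
      (lift (fixedField (ramificationGroupIn OE N))).toSubfield ≤
        Subfield.closure (Set.range (algebraMap S E) ∪ (t : Set E)) ∧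
      ∃ hTO : (Algebra.adjoin S (t : Set E)).toSubring ≤ OE.toSubring,
        IsRegularLocalRing (Localization.AtPrime
          (Ideal.comap (Subring.inclusion hTO) (maximalIdeal OE))) :=
    IsPrimeGaloisTower.induction_between
      (A₀ := (lift (fixedField (inertiaGroupIn OE N))).toSubfield)
      (B := (lift (fixedField (ramificationGroupIn OE N))).toSubfield)
      (fun M => ∃ t : Finset E, (t : Set E) ⊆ M ∧
        M ≤ Subfield.closure (Set.range (algebraMap S E) ∪ (t : Set E)) ∧
        ∃ hTO : (Algebra.adjoin S (t : Set E)).toSubring ≤ OE.toSubring,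
          IsRegularLocalRing (Localization.AtPrime
            (Ideal.comap (Subring.inclusion hTO) (maximalIdeal OE))))
      (fun A B hA hB hstep hIA => hC3 S hS hSdim hSchar hScomp E hinj hE halg OE hSO hdom
        hres hrank F₀ hSF₀ N A B hA hB hstep hIA)
      le_rfl (isPrimeGaloisTower_inertiaField_ramificationField_of_charZero OE N) hINVi
  -- (4) `Fʳ = N`: no climb above the ramification field is needed
  have hFrN : (lift (fixedField (ramificationGroupIn OE N))).toSubfield = N.toSubfield :=
    lift_fixedField_ramificationGroupIn_toSubfield_eq_of_charZero OE N
  -- (5) `(LU on N) ⇒ (LU on K)`: descent below the ramification field of `N | K`, which is `N`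
  obtain ⟨L₀', hL₀', -⟩ :=
    exists_intermediateField_lift_toSubfield_eq N Ki.toSubfield hF₀Ki (fun x hx => hKiN hx)
  haveI := finiteDimensional_extendScalars_lift L₀'
  haveI := isGalois_extendScalars_lift L₀'
  have hMK : (lift L₀').toSubfield ≤ (lift (fixedField (ramificationGroupIn OE N))).toSubfield := by
    rw [hFrN]
    exact lift_toSubfield_le L₀'
  have hKram : (lift (fixedField (ramificationGroupIn OE N))).toSubfield ≤
      (lift (fixedField (ramificationGroupIn OE
        (Subfield.extendScalars (lift_toSubfield_le L₀'))))).toSubfield := by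
    rw [hFrN, lift_fixedField_ramificationGroupIn_toSubfield_eq_of_charZero OE
      (Subfield.extendScalars (lift_toSubfield_le L₀'))]
    exact fun x hx => (mem_extendScalars_lift_iff L₀' x).mpr hx
  have hSL₀' : ∀ s : S, algebraMap S E s ∈ (lift L₀').toSubfield := fun s =>
    le_lift_toSubfield _ (hSF₀ s)
  have hINVL₀' := hC4 S hS hSdim hSchar hScomp E hinj hE halg OE hSO hdom hres hrank
    (lift L₀').toSubfield hSL₀' (Subfield.extendScalars (lift_toSubfield_le L₀'))
    (lift (fixedField (ramificationGroupIn OE N))).toSubfield hMK hKram hINVr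
  rw [hL₀'] at hINVL₀'
  -- (6) conclusion
  obtain ⟨t, htK, hKcl, hTO, hreg⟩ := hINVL₀'
  refine ⟨t, by rwa [hKi] at htK, fun z hz => hKcl ?_, hTO, hreg⟩
  rw [hKi]
  exact Subfield.subset_closure (Set.mem_union_right _ hz)

/-- **`CossartPiltant2019LUCompleteChar0` from principalization (Prop. 4.4) and the three
remaining characteristic-free inputs (C3) tame ascent, (C4) descent, (C5) reduction to rank one**
of the proof of Cossart–Piltant 2019, Prop. 4.10: `CossartPiltant2019LUCompleteChar0.of_parts`
with (COF) discharged by `cofinality_of_principalization₀`.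
[cite: CossartPiltant2019, Prop. 4.4 and proof of Prop. 4.10 (arXiv v1: Prop. 4.8, pp. 53–54)]
[cite: CossartPiltant2008, Cor. 4.6] -/
theorem CossartPiltant2019LUCompleteChar0.of_principalization
    (h44 : CossartPiltant2019Principalization.{u})
    (hC3 :
      ∀ (S : Type u) [CommRing S] [IsDomain S] [IsRegularLocalRing S],
        IsExcellentRing S → ringKrullDim S = 3 → CharZero (ResidueField S) →
        IsAdicComplete (maximalIdeal S) S →
      ∀ (E : Type u) [Field E] [Algebra S E], Function.Injective (algebraMap S E) →
        IsAlgClosed E → Algebra.IsAlgebraic S E →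
      ∀ (OE : ValuationSubring E), (∀ s : S, algebraMap S E s ∈ OE) →
        (∀ s ∈ maximalIdeal S, OE.valuation (algebraMap S E s) < 1) →
        (∀ y : OE, ∃ q : S[X], (∃ i, q.coeff i ∉ maximalIdeal S) ∧
          OE.valuation (q.eval₂ (algebraMap S E) y) < 1) →
      Nonempty OE.valuation.RankOne →
      ∀ (M : Subfield E), (∀ s : S, algebraMap S E s ∈ M) →
      ∀ (N : IntermediateField M E) [FiniteDimensional M N] [IsGalois M N] (A B : Subfield E),
        (lift (fixedField (inertiaGroupIn OE N))).toSubfield ≤ A →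
        B ≤ (lift (fixedField (ramificationGroupIn OE N))).toSubfield →
        IsPrimeGaloisStep 0 A B →
        (∃ t : Finset E, (t : Set E) ⊆ A ∧
          A ≤ Subfield.closure (Set.range (algebraMap S E) ∪ (t : Set E)) ∧
          ∃ hTO : (Algebra.adjoin S (t : Set E)).toSubring ≤ OE.toSubring,
            IsRegularLocalRing (Localization.AtPrime
              (Ideal.comap (Subring.inclusion hTO) (maximalIdeal OE)))) →
        (∃ t : Finset E, (t : Set E) ⊆ B ∧
          B ≤ Subfield.closure (Set.range (algebraMap S E) ∪ (t : Set E)) ∧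
          ∃ hTO : (Algebra.adjoin S (t : Set E)).toSubring ≤ OE.toSubring,
            IsRegularLocalRing (Localization.AtPrime
              (Ideal.comap (Subring.inclusion hTO) (maximalIdeal OE)))))
    (hC4 :
      ∀ (S : Type u) [CommRing S] [IsDomain S] [IsRegularLocalRing S],
        IsExcellentRing S → ringKrullDim S = 3 → CharZero (ResidueField S) →
        IsAdicComplete (maximalIdeal S) S →
      ∀ (E : Type u) [Field E] [Algebra S E], Function.Injective (algebraMap S E) →
        IsAlgClosed E → Algebra.IsAlgebraic S E →
      ∀ (OE : ValuationSubring E), (∀ s : S, algebraMap S E s ∈ OE) →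
        (∀ s ∈ maximalIdeal S, OE.valuation (algebraMap S E s) < 1) →
        (∀ y : OE, ∃ q : S[X], (∃ i, q.coeff i ∉ maximalIdeal S) ∧
          OE.valuation (q.eval₂ (algebraMap S E) y) < 1) →
      Nonempty OE.valuation.RankOne →
      ∀ (M : Subfield E), (∀ s : S, algebraMap S E s ∈ M) →
      ∀ (N : IntermediateField M E) [FiniteDimensional M N] [IsGalois M N] (K' : Subfield E),
        M ≤ K' → K' ≤ (lift (fixedField (ramificationGroupIn OE N))).toSubfield →
        (∃ t : Finset E, (t : Set E) ⊆ K' ∧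
          K' ≤ Subfield.closure (Set.range (algebraMap S E) ∪ (t : Set E)) ∧
          ∃ hTO : (Algebra.adjoin S (t : Set E)).toSubring ≤ OE.toSubring,
            IsRegularLocalRing (Localization.AtPrime
              (Ideal.comap (Subring.inclusion hTO) (maximalIdeal OE)))) →
        (∃ t : Finset E, (t : Set E) ⊆ M ∧
          M ≤ Subfield.closure (Set.range (algebraMap S E) ∪ (t : Set E)) ∧
          ∃ hTO : (Algebra.adjoin S (t : Set E)).toSubring ≤ OE.toSubring,
            IsRegularLocalRing (Localization.AtPrime
              (Ideal.comap (Subring.inclusion hTO) (maximalIdeal OE)))))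
    (hC5 :
      ∀ (S : Type u) [CommRing S] [IsDomain S] [IsRegularLocalRing S],
        IsExcellentRing S → ringKrullDim S = 3 → CharZero (ResidueField S) →
        IsAdicComplete (maximalIdeal S) S →
      ∀ (E : Type u) [Field E] [Algebra S E], Function.Injective (algebraMap S E) →
        IsAlgClosed E → Algebra.IsAlgebraic S E →
      (∀ (OE : ValuationSubring E), Nonempty OE.valuation.RankOne →
        (∀ s : S, algebraMap S E s ∈ OE) →
        (∀ s ∈ maximalIdeal S, OE.valuation (algebraMap S E s) < 1) →
        (∀ y : OE, ∃ q : S[X], (∃ i, q.coeff i ∉ maximalIdeal S) ∧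
          OE.valuation (q.eval₂ (algebraMap S E) y) < 1) →
        ∀ s₀ : Finset E, ∃ t : Finset E,
            (t : Set E) ⊆ Subfield.closure (Set.range (algebraMap S E) ∪ (s₀ : Set E)) ∧
            (s₀ : Set E) ⊆ Subfield.closure (Set.range (algebraMap S E) ∪ (t : Set E)) ∧
            ∃ hTO : (Algebra.adjoin S (t : Set E)).toSubring ≤ OE.toSubring,
              IsRegularLocalRing (Localization.AtPrime
                (Ideal.comap (Subring.inclusion hTO) (maximalIdeal OE)))) →
      ∀ (OE : ValuationSubring E), (∀ s : S, algebraMap S E s ∈ OE) →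
        (∀ s ∈ maximalIdeal S, OE.valuation (algebraMap S E s) < 1) →
        (∀ y : OE, ∃ q : S[X], (∃ i, q.coeff i ∉ maximalIdeal S) ∧
          OE.valuation (q.eval₂ (algebraMap S E) y) < 1) →
        ∀ s₀ : Finset E, ∃ t : Finset E,
            (t : Set E) ⊆ Subfield.closure (Set.range (algebraMap S E) ∪ (s₀ : Set E)) ∧
            (s₀ : Set E) ⊆ Subfield.closure (Set.range (algebraMap S E) ∪ (t : Set E)) ∧
            ∃ hTO : (Algebra.adjoin S (t : Set E)).toSubring ≤ OE.toSubring,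
              IsRegularLocalRing (Localization.AtPrime
                (Ideal.comap (Subring.inclusion hTO) (maximalIdeal OE)))) :
    CossartPiltant2019LUCompleteChar0.{u} := by
  refine CossartPiltant2019LUCompleteChar0.of_parts ?_ hC3 hC4 hC5
  intro S _ _ _ hS hSdim _ _ E _ _ hinj _ halg OE hSO hdom hres M hSM t htM hMcl hTO hreg c hcM hcO
  obtain ⟨t', -, ht'M, hMcl', hTO', hreg', hrep⟩ := cofinality_of_principalization₀ h44 hS hSdim
    hinj OE hSO hdom hres M hSM t htM hMcl hTO hreg c hcM hcO
  exact ⟨t', ht'M, hMcl', hTO', hreg', hrep⟩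

end Parts

end Literature.AlgebraicGeometry.Resolution

end
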